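import Mathlib
import HarnessLib
import HarnessLib.Audit
import Summits.NavierStokesRegularity.Statement
import Literature.Analysis.FluidPDE.TaoAveragedCascade
import Literature.Analysis.FluidPDE.TaoAveragedSingleScaleAt
import Literature.Analysis.FluidPDE.TaoAveragedIsoscelesDegeneracy
import Literature.Analysis.FluidPDE.Tao2016AveragedNS.SplitDelayCircuitChannels
import Literature.Analysis.FluidPDE.Tao2016AveragedNS.SplitCascadeLocalBlowup
import Literature.Analysis.FluidPDE.Tao2016AveragedNS.SplitCascadeFrame
import HarnessLib.Audit.Status.Attr

/-!
Route: TaoLadderRungOne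

CLOSED (proved) 2026-08-27T19:08:06Z by planner-director-ns-g9-0 — reason: proved:Summit.NavierStokesRegularity.NavierStokesRegularity.Theorems.taoLadderRungOne_target_proof — note: D-0092 director verb (director-ns g9): rung-leaf TL-M1 decided in kernel — Target 19871 CLOSED·PROVED 18:33:45Z by p555552 (prover-harvest-h2-tao-ladder-p1-g8-0); all binders tree theorems since p553370; tribunal-ns J ADD. 7 5d8dff401e43b6be (moot-by-proof); MODEL statement about Tao's averaged NS, . The file is kept as the record of this route; refuted decls are indexed as negative knowledge (`ledger negatives`).

# Route TaoLadderRungOne — Tao's averaged Navier–Stokes blow-up WITHOUT dilation averaging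
(TAO-LADDER rung M_1) via the split local cascade operator whose input pairs never have equal
modulus

RUNG-LEAF ROUTE (D-0061; leaf = TAO-LADDER rung M_1 of cell harvest/h2-tao-ladder = this route's own
`Target` item; MODEL EQUATIONS ONLY — it does NOT claim Clay (A)–(D) and says nothing about true
Navier–Stokes). Target (M_1) = Tao's Theorem 1.5 (finite-time blow-up of a mild H¹⁰_df solution of
an averaged Navier–Stokes equation ∂ₜu = Δu + B̃(u,u) with a symmetric averaging datum obeying the
cancellation ⟨B̃(u,u),u⟩ = 0) with EVERY random dilation factor λ = 1, i.e. the averaged operator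
uses rotations and order-zero Fourier multipliers only — the «slightly stronger version of Theorem
1.5 in which one does not use any averaging over dilations» that Tao 2016 Remark 3.5 names and does
not pursue. It suffices to show X = R1-a ∧ R1-b for the SPLIT local cascade operators C♯ (finite
real combinations of Tao's basic cascade forms (3.5) whose three profiles have Fourier support in
balls of radius ε₀/64 about ±ζᵢ with input moduli separated, |‖ζ₁‖ − ‖ζ₂‖| ≥ ε₀/20): R1-a =
SplitCascadeIsAveragedNoDil (every split form of scale parameter ε₀ ≤ ε₁ IS a dilation-free averaged
Euler form, «Theorem 3.2♭») and R1-b = SplitCascadeBlowup (for ε₀ ≤ ε₂ some symmetric cancelling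
split form blows up from Schwartz divergence-free data, «Theorem 3.3♯»). No idea card is realised
(cell-internal ladder rung; lens oqh: a question left open in print).
Lean:
`Summit.NavierStokesRegularity.NavierStokesRegularity.Theses.TaoLadderRungOne.SplitCascadeIsAveragedNoDil
∧ Summit.NavierStokesRegularity.NavierStokesRegularity.Theses.TaoLadderRungOne.SplitCascadeBlowup`

## Assembly
Pure logic plus Tao's p. 14 paragraph «Theorem 1.5 ⇐ Theorems 3.2 + 3.3» with the dilation
constraint carried through, PROVED in glue.lean (`closes`, kernel-checked in the cell mock, axioms
propext / Classical.choice / Quot.sound; port of the cell's g2 theorem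
`noDilationAveragedNSBlowup_of_split`, rung1/TaoLadderRung1.lean sha16 c2e595d8605deeed): at ε₀ =
min ε₁ ε₂, R1-b gives a symmetric cancelling split form T with a bad datum u₀; R1-a gives a
dilation-free 𝒜 with B̃_𝒜 = T on H¹⁰_df × H¹⁰_df × H¹⁰_df(ℂ); symmetry and cancellation transfer
through this identity (real test fields embed by `MemH10df.memH10dfC`), and a global 𝒜-mild solution
would be a global T-mild solution because the two Duhamel identities differ only in the trilinear
form evaluated at H¹⁰_df arguments (`Tao2016.memH10df_heat`).

CLOSES_TARGET: closes rung TL-M1 of NavierStokesRegularity: Summit.NavierStokesRegularity.NavierStokesRegularity.Theses.TaoLadderRungOne.Target (D-0061; not the summit Statement) — the deciding theorem of this route concludes that registered leaf instead of the Statement decl `NavierStokesRegularity` (class rung: servable and labelled, never counted as concluding the summit Statement).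

Rationale: WHY THIS LINE. Tao's proof of Theorem 1.5 [Tao2016AveragedNS = doi:10.1090/jams/838 =
arXiv:1402.0290, §§3–6] uses the dilation average exactly once: in Theorem 3.2 (every local cascade
operator is an averaged Euler form) to move the three base frequencies ξ⁰ᵢ to the normalised
position (3.7); everything downstream (Theorem 3.3: cascade reduction §4, delay circuit §5, infinite
induction §6) never sees the averaging datum. The tree theorem `Tao2016.cSigma_eq_zero_of_isosceles`
(p373049) with the cell referee's Cycle-5 computation shows that WITHOUT dilations the single-scale
representation degenerates precisely on isosceles input pairs ‖ξ⁰₁‖ = ‖ξ⁰₂‖ — and Tao's circuit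
(5.5) feeds its pump and amplifier gates through squared modes X₁,ₙX₁,ₙ and X₂,ₙX₂,ₙ, i.e. through
equal-modulus input pairs: removing (A-dil) is therefore NOT a re-reading of the printed proof
(referee theorem: no homochiral equal-modulus input coupling is representable without dilations),
and the new object is forced: SPLIT every squared mode into two copies at moduli ratio 1 + ε₀/10
inside one shell (operator C♯, nine modes per scale transfer instead of five), so that every input
pair is off the degeneracy by a margin ≥ 3ε₀/160 while the symmetric part of the doubled circuit is
exactly Tao's (tree: `splitDelayCircuit_diagEmbed`, `splitDelaySolution_hasAbruptTransition`,
p467702/p472543). What is imported: harmonic analysis of the rotation/multiplier average at a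
general admissible frequency triple (tree `TaoAveragedSingleScaleAt`, p375051/p469051, and the
quantitative non-degeneracy `norm_cSigma_ge_of_sides_mem_Icc`, κ_eq = √3/16, p465724) for R1-a; ODE
shadowing of the doubled delay circuit with a structured asymmetry budget (tree
`SplitDelayCircuitShadowing` / `SplitDelayCircuitChannels`, p472543–p475248: amplifier channel pure
damping while the clock is non-negative, rotor terms cancel in ∂(Y_a²+Y_d²)) for R1-b. No existing
route touches the averaging class from the blow-up side except PerpetualPump's
`AveragedTypeIBlowup_of` (Type-I rate INSIDE Tao's full class M_0, dilations allowed); the negatives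
index entry stmt-1832 refutes only the universal «every symmetric cancelling averaged NS is
regular», which our existential Target is consistent with (indeed Target →
`Tao2016.averagedNS_blowup`, checked in the cell mock).

RANKED CRUXES. #0 Target (target) — M_1 = Tao's Theorem 1.5 without dilation averaging: there is an
averaging datum 𝒜 = (Ω, μ, m, R, λ) with λ ≡ 1 (rotations in SO(3) and real, even, order-zero
multipliers only), symmetric (B̃ invariant under permuting the three tensor slots of m and R) and
cancelling (⟨B̃(u,u),u⟩ = 0 on H¹⁰_df), and a Schwartz divergence-free u₀, such that the averaged
Navier–Stokes equation has NO global mild H¹⁰_df solution on [0,∞) from u₀ (by Tao's local theory,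
Prop. 1.6, equivalently: the maximal mild solution blows up in finite time). This is the rung leaf;
it is decided by `closes` from the two cruxes. (why it might fail: Without dilations the averaged
class may be too rigid for ANY blow-up: the isosceles degeneracy already kills Tao's own operator C,
and a second hidden obstruction (output/rotor couplings at general triples, or an n₀-dependence that
cannot close) could make every dilation-free datum regular.) [Tao2016AveragedNS,
doi:10.1090/jams/838, arXiv:1402.0290, paper:url-af84c58f41f8]
#2 SplitCascadeBlowup (crux) — R1-b «Theorem 3.3♯» (cell LADDER.md §7.11, rung1/TaoLadderRung1.lean
`splitCascade_blowup`): there is ε₂ > 0 such that for every 0 < ε₀ ≤ ε₂ some SPLIT local cascade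
form T of scale parameter ε₀ (a finite real combination Σⱼ cⱼ·basicCascadeForm ε₀ ψⱼ₁ ψⱼ₂ ψⱼ₃ whose
profiles have annular Fourier support (3.4) refined to balls of radius ε₀/64 about ±ζⱼᵢ, with input
moduli gap |‖ζⱼ₁‖ − ‖ζⱼ₂‖| ≥ ε₀/20) is symmetric in its first two slots, satisfies the cancellation
T(u,u,u) = 0 on H¹⁰_df, and admits a Schwartz divergence-free datum u₀ from which ∂ₜu = Δu + T(u,u)
has no global mild H¹⁰_df solution on [0,∞). Intended witness: C♯ = Tao's (5.5)/(6.2)-table with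
each squared mode doubled (pump X₁′X₁″ → X₂, amplifier X₂′X₂″X₃ → X₃, rotor and output gates acting
on the symmetric combinations), datum loading both copies equally (X(0) = diagEmbed of Tao's datum —
NECESSARY by the cell's staged `not_odeBlowupShape_of_squareFree`), blow-up by Tao's §4 reduction +
§5 circuit + §6 induction re-run with an asymmetry (Y) budget. [difficulty: L] (why it might fail:
The two copies of each doubled mode may desynchronise: asymmetries are re-forced at size δₙ by the
§4 errors every epoch, and the induction (Prop. 6.5♯ with Y-clauses, ε ≤ exp(−C·10⁷K¹⁰), n₀ ≥ N_Y)
must keep them inside the gates' shadowing radius for infinitely many scales — unproved.)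
[Tao2016AveragedNS, arXiv:1402.0290, paper:url-af84c58f41f8] — STATUS 2026-08-27: PROVED (item
stmt-19872 CLOSED 10:58:36Z by
`Summit.NavierStokesRegularity.NavierStokesRegularity.Theorems.splitCascadeBlowup_proof`, p525678;
chain: split Prop. 6.5♯ `rescaledSplitStep_holds` + Thm 6.2♯ `noGlobalSplit_holds` (p522747), Thm
4.2♯/3.3♯ `splitOdeBlowup_holds`/`splitLocalCascade_blowup` (p523889), packaging
`cascadeOperatorForm_isSplitLocalCascadeForm` (p524984); referee c19: unconditional, std axioms; the
gen-1 split children 20308–20310 are moot).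
#3 SplitCascadeIsAveragedNoDil (crux) — R1-a «Theorem 3.2♭» (cell LADDER.md §7.11,
rung1/TaoLadderRung1.lean `splitCascade_isAveragedNoDil`): there is ε₁ > 0 such that for every 0 <
ε₀ ≤ ε₁, EVERY split local cascade form T of scale parameter ε₀ (same clause as in
SplitCascadeBlowup) is a dilation-free averaged Euler form: there is an averaging datum 𝒜 with λ ≡ 1
whose trilinear form B̃_𝒜(u,v,w) equals T(u,v,w) for all u, v ∈ H¹⁰_df and complex test fields w ∈
H¹⁰_df(ℂ). Route inside the crux (Tao §3.2–3.9 with (3.7) replaced by a general admissible triple):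
dyadic shells pass through rotations and order-zero multipliers, so it suffices to represent one
basic split form; decompose the ball-supported profiles into pieces of radius ≪ ε₀² (§3.6),
represent each single-scale piece by the uniform no-dilation single-scale lemma L-1q (tree
`singleScaleAt_isComplexAverageNoDil_xi0_iff` gives representability at one admissible triple iff
c_σ(ξ⁰) ≠ 0; `norm_cSigma_ge_of_sides_mem_Icc` gives |c_σ| ≥ (√3/16)·gap uniformly), sum (§3.8) and
take real parts (§3.9). [difficulty: L] (why it might fail: Tao proves the dilation-free identity
(3.9) only at the normalised triple (3.7); at general admissible triples the (3.24) margin is ~ the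
input-modulus gap, so the §3.6–3.8 constants degrade like gap⁻¹ and radius ε₀/64 vs gap ε₀/20 may be
too weak for ONE uniform ε₁ (else restate: radius ≤ c·gap).) [Tao2016AveragedNS, arXiv:1402.0290,
paper:url-af84c58f41f8] — STATUS 2026-08-27: the ONLY open crux; SPLIT gen-1 (rev 4) into the
layer-2 items SingleScaleNoDilAt (crux, first of the layer, L: «L-1q uniform» — Tao's dilation-free
single-scale identity (3.9) at EVERY closed base triangle with sides in [4/5,3/2] and input gap ≥
κε₀, threshold ε₁(κ); the rung-1 break point; why it might fail: the (3.24) margin there is only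
≍κε₀, so every §3.6–3.8 smallness condition must be RELATIVE — O(ε₀³)·Lip on Γ),
CascadeNoDilOfSingleScaleAt (support, M: §3.3–§3.4 + transitivity at a general base triple,
dilation-free; the xi0 case is KERNEL — `Tao2016.normalised_isComplexAverageNoDil`,
`cascade_of_singleScale_noDil`, p527827) and SplitNoDilPackaging (support, M: rotations-only
normalisation of the pieces + the LANDED dilation-free closure
`Tao2016.isAveragedNoDil_of_basicNoDil`, p526912 — §3.2 ¶1, §3.1 with λ ≡ 1, ℂ-linear extension),
glue SplitCascadeIsAveragedNoDilOfSplit CLOSED PROVED (stmt-20435, p531384 — the planner's candidate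
landed by p1 g5; ε₁ = min of the two thresholds, [4/5,3/2] ⊆ [1/2,2]); K3 SplitNoDilPackaging CLOSED
PROVED (stmt-20474, p530727, p1 g5: §3.2 ¶2 rotations-only packaging, κ = 1/64); skeleton `Lines`
registered on stmt-19873 with the three children as its stubs by name (v1 e8becd9d, v2 64d8cabc
after the c21 window restates [4/5,3/2], revs 6–9). STATUS at rev 10: the rung leaf TaoLadderM1 is
MINTED and this route is OPEN (closes-target set, glue.ok); R1-a SplitCascadeIsAveragedNoDil ⇐ K1
SingleScaleNoDilAt (stmt-20473, crux, L — BC5 rung at xi0 attached, gap discharged) + K2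
CascadeNoDilOfSingleScaleAt (stmt-20433, support, M — xi0 kernel p527827; p1 g5 report §8 lists the
exact xi0-dependences of RhoSymbol/BetaForm/CascadeOfSingleScale to parametrise). IN THE KERNEL the
only use of dilation averaging in Tao's Theorem 3.2 is the normalisation step (5) (Remark 3.5's
first sentence, now a tree fact at xi0).

TWO-LAYER PLAN. FILED 2026-08-27 (rev 4): SplitCascadeIsAveragedNoDil ⇐ SingleScaleNoDilAt →
CascadeNoDilOfSingleScaleAt → SplitNoDilPackaging → SplitCascadeIsAveragedNoDil (glue proved) — this
realises the foreseen RungOneL1qLite/SingleScaleAssembly split below with the harmonic analysis cut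
one level finer (the single-scale identity at a general triangle is the crux; §3.3–3.4 and the
packaging are separate M items). As foreseen at open (kept for the record; each becomes `route edit
--split` once its sibling moves, or a registered skeleton under Cruxes/<Decl>/Lines/):
SplitCascadeIsAveragedNoDil ⇐ RungOneL1qLite → SingleScaleAssembly → SplitCascadeIsAveragedNoDil,
where RungOneL1qLite (cell rung1/TaoLadderRung1.lean: uniform no-dilation single-scale lemma — gap ≥
ε₀/64 at radius 2ε₀, profile radius ≤ ε·gap ⇒ complex-average representable with λ ≡ 1, one ε for
all admissible triples) carries the harmonic analysis and SingleScaleAssembly (Tao §3.6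
decomposition into radius-ε₀² pieces + rotation covariance + §3.8 finite sums + §3.9 real parts) is
M-sized glue. SplitCascadeBlowup ⇐ SplitWaveletData → SplitCascadeODEBlowup → SplitCascadeReduction
→ SplitCascadeBlowup (birth skeleton `Cruxes/SplitCascadeBlowup/Lines/birth.lean`: stubs
`stub_splitWaveletData` (S/M: m ≤ 9 frequency balls of radius ≤ ε₀/128 with pairwise centre-modulus
gaps ≥ ε₀/20), `stub_splitODEBlowup`, `stub_splitReduction`, composition `SplitCascadeBlowup_of`
kernel-checked), where SplitCascadeODEBlowup = «Theorem 4.2♯/6.2♯» (the infinite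
nine-mode-per-transfer ODE system of C♯ with the two-copy datum has no global solution of the stated
shape — one epoch is ALREADY a tree theorem at circuit/pseudo-orbit level:
`splitPseudoOrbit_delayedAbruptTransition_of_clock_nonneg`, p475248 — referee Cycle 7 reading: valid
in the n₀-small defect regime (its symmetric-side Grönwall constant carries delayLipschitz ≥
4ε⁻²R′), so it is a first rung and a source of channel lemmas for the §6 induction, not a drop-in
for it; the §6 induction `RescaledHypothesesY` is the open core, residual G-R1b) and
SplitCascadeReduction = «Lemma 4.1♯ + Theorem 4.2-shape» (the split wavelet ansatz u = Σ Xᵢ,ₙ(t)ψᵢ,ₙ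
+ error reduces T-mild blow-up to the ODE statement; Tao §4 verbatim with 9 profiles per scale).

KILL CRITERIA. refuted:SplitCascadeBlowup with a SUBSTANTIVE witness (e.g. a theorem that every
symmetric cancelling split form has global mild solutions from all Schwartz data — a
desynchronisation instability of the doubled gates that no datum avoids) kills the C♯ line; the
pivot of record is the referee's alternative R-16 (HELICITY-split operator: distinct helical
polarisations instead of distinct moduli), filed as a new crux pair on this route only if R1-a's
analogue for it type-checks, else `route close --reason refuted:SplitCascadeBlowup`.
refuted:SingleScaleNoDilAt with a SUBSTANTIVE witness (for some κ > 0 no threshold ε₁ exists — e.g.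
a theorem that at near-isosceles closed triangles every dilation-free complex averaging datum
representing C₀ violates the moment condition (3.5), i.e. the 1/c_σ weight is not merely large but
non-integrable) kills the split-operator mechanism at rung 1 unless the gap can be made ≫ ε₀ (it
cannot inside Def. 3.1's annulus: pivot = the helicity split R-16 or complex-coefficient tables);
refuted:SingleScaleNoDilAt because of the window [4/5,3/2] or the order of quantifiers (∀κ ∃ε₁) is
class MISSTATED: repair = the instance the packaging needs (κ = 1/64, sides in [1−3ε₀, 1+3ε₀]).
refuted:SplitCascadeIsAveragedNoDil because of the constants (1/64, 1/20, one uniform ε₁) is class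
MISSTATED: repair = the restated item with profile radius ≤ c·gap (the REPACKAGED contract R-5′ of
LADDER §7.10) and the matching restatement of SplitCascadeBlowup's clause. A proof of ¬Target (every
dilation-free symmetric cancelling averaged NS is globally regular for Schwartz data) closes the
route outright AND is rung news of the first order (a regularity mechanism that sees only the
dilation structure) — file it as the negative item when a refuter wants it staffed. Mooted
(superseded) if Target is proved by any other witness (helicity split, complex-coefficient tables):
the leaf closes and this route is `superseded`.

NOT DECOMPOSED YET. (2026-08-27: the single-scale lemma and its assembly ARE now items — the gen-1
split of SplitCascadeIsAveragedNoDil; below SingleScaleNoDilAt nothing is filed: its internal steps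
— §3.5 symbol extraction at ξ, §3.6 plane-wave synthesis (tree `planeWaveSynthesis_holds`,
base-point free), §3.7 closing rotations at a general non-collinear triangle, §3.8–3.9 joint weight
with the relative (3.24) margin — are prover-attached `--supports` lemmas, never a third layer.)
Deliberately NOT items at open (layer-2 children or prover-attached lemmas later): Lemma 4.1♯ (local
strong solutions and the error class for split wavelet sums); the nine-mode «Theorem 4.2♯/6.2♯»; the
one-epoch theorem with Y-budget (tree, p475248) and the joint induction `RescaledHypothesesY` with
its explicit side conditions (G2 ε ≤ ε_Y′ = exp(−C·10⁷K¹⁰) load-bearing, G3 n₀ ≥ N_Y = 404λK/ε₀, G4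
rotor coherence); the real-frame existence of ball-Fourier-supported Schwartz profiles (E1; complex
frame done: `Tao2016.exists_ne_zero_hasBallFourierSupport`, p469051); all numerical constants (1/64,
1/20, 1 + ε₀/10, C_P = 5·10⁶ε²/ε₀, C_H·K = 103λK + 60λK⁻⁹/ε₀, C_R) — provisional, restatable as a
misstated-class repair without touching the thesis.

CHEAPEST FALSIFIER. (1) STATEMENT-LEVEL, run: does a split form still contain an equal-modulus input
pair (which the referee's Cycle-5 theorem + `cSigma_eq_zero_of_isosceles` would make
non-representable, killing R1-a as typed)? No — with profile radius ε₀/64 and centre-moduli gap ≥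
ε₀/20 any two input frequencies differ in modulus by ≥ ε₀(1/20 − 2/64) = 3ε₀/160 > 0 (arithmetic).
(2) DATUM, run by the cell (staged `not_odeBlowupShape_of_squareFree`, lean rc 0): a square-free
table with Tao's SINGLE-wavelet datum (4.7) is globally regular — so R1-b's datum must load both
copies; R1-b quantifies ∃ u₀, unaffected. (3) NUMERICAL SCREEN, run (kit jobs j260179–81,
j260597–99; independent re-run j261022 agrees to 3 digits): δ-pseudo-orbits of the doubled circuit
at toy parameters show asymmetry LINEAR in δ, no instability, hand-off exponent n₀-free (2.3K) —
consistent with R1-b, not evidence for it. (4) For SingleScaleNoDilAt, desk-cheap and decisive for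
the threshold (referee c20: «bound C first»): compute the Lipschitz constant of η ↦ c_σ(η) (§3.9
formula, tree `cSigma`) on Γ ⊆ Πⱼ B(ξⱼ, Cε₀³) over the compact family of closed triangles with sides
in [4/5,3/2] and compare Lip·Cε₀³ with the margin |⟪u₀×n,η₁⟫|·κε₀/180
(`norm_cSigma_ge_of_sides_mem_Icc`): the crossover gives ε₁(κ) explicitly (expected ≍ √κ); if
instead some §3.7–3.8 error is only O(ε₀) absolute, the item is misstated and the repair is profile
radius ≤ c·gap. Still open and cheap for a refuter: instantiate R1-a at ONE non-normalised
admissible triple with gap exactly ε₀/20 and profile radius ε₀/64 and test the §3.7 perturbation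
bound numerically (κ_eq·gap against radius·sup|∇c_σ|): either outcome is informative
(misstated-class restatement vs. confidence in 1/64).

NUMBERS. κ_eq = √3/16 ≈ 0.108 = uniform lower bound |c_σ(ξ⁰)| ≥ κ_eq·gap on admissible triples with
sides in the (3.25) window (tree `Tao2016.norm_cSigma_ge_of_sides_mem_Icc`, p465724). Split ratio
‖ζ₁‖/‖ζ₂‖ = 1 + ε₀/10 inside one (3.4) shell; profile radius ε₀/64; input gap ≥ ε₀/20; separation
margin 3ε₀/160. Circuit constants as printed (Theorem 5.3: K ≥ K₀, 0 < ε ≤ ε₁(K), t_c = √2 +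
O(K^(−1/2)), errors C·K⁻¹⁰) hold verbatim for the symmetric part of C♯ (tree
`splitDelaySolution_hasAbruptTransition`); asymmetry channel rates λ and 2M only, no ε⁻¹K¹⁰ and no
ε⁻² as a rate (tree `IsPseudoOrbit.asym_c_sq_le_of_clock_nonneg`, `asym_ad_sq_le_of_clock_nonneg`,
p474012–p475248); Y-budget thresholds of record (cell KIV-YRECAST.md 0057aef426eb1bee, referee Cycle
6): ε ≤ ε_Y′ = exp(−C·10⁷K¹⁰), n₀ ≥ N_Y = 404λK/ε₀, drain target η₀e^(101λK) ≤ K⁻¹⁰. BC9 for the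
tribunal: method_family = frequency-cascade blow-up construction for averaged/model equations
(Katz–Pavlović / Cheskidov dyadic models → Tao 2016 averaged NS); ceiling in print = the averaged
class itself (Tao 2016 Thm 1.5 = M_0 proved; Remark 3.5 names M_1 as unpursued; §1.3 explains why
the programme stops short of true NS: no known way to suppress the non-cascade interactions) — the
ladder M_1 … M_7 de-averages one freedom per rung and is capped, as a method, strictly below true NS
(FRONTIER ledger, referee-grade rungs; never distance-to-Clay).

DEFINITION REQUESTS. None required: the three cell helper predicates (IsDilationFree 𝒜 := ∀ i θ,
𝒜.lam i θ = 1; HasRealBallFourierSupport ζ r ψ := 𝓕ψ = 0 off B(ζ,r) ∪ B(−ζ,r);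
IsSplitLocalCascadeForm ε₀ T) are INLINED verbatim into the items (faithfulness certified by
`Iff.rfl` lemmas in the cell mock pkg/GlueScratch.lean against byte-copies of
rung1/TaoLadderRung1.lean). OPTIONAL (prover convenience, no route change): land them as
`Literature/Analysis/FluidPDE/Tao2016AveragedNS/SplitCascadeForm.lean` with the three `iff` lemmas
to the route items (cell hand-off h1′; blocked today only by the cell-topic allowlist,
OPS-REQUESTS). Cite facts wanted: none new (Tao2016AveragedNS is in references.bib and held as
paper:url-af84c58f41f8).

Novelty: Searches (2026-08-26/27): lit search --hybrid "averaged Navier-Stokes blowup dilation averaging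
non-degeneracy local cascade operator" -n 10 → generic NS monographs only, 0 relevant; lit read
paper:url-af84c58f41f8 --grep "dilation" → p.6 L61–63 (referee footnote), p.18 L44–52, p.27 L2–15
(Remark 3.5) [corpus]; lit galaxy search "dilation averaging|averaging over dilations|local cascade
operator" --star all -n 10 → 3 rows, none on averaged NS; lit galaxy search "averaged Navier-Stokes
equation|averaged Euler equation|averaged Navier–Stokes" --star pdf -n 15 → 15 Reynolds-averaging
rows, 0 relevant; lit citing doi:10.1090/jams/838 --since 2016 → 262 citers (80 listed), none
removes an averaging freedom; ledger negatives --problem NavierStokesRegularity → 5 entries, none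
equal or trivially equivalent; lean search 'lam i θ = 1' / 'IsDilationFree' → no tree decl; tree
Theses scan → PerpetualPump (`AveragedTypeIBlowup_of`) is the only blow-up-side averaged route.
Nearest prior art found: [corpus:paper:url-af84c58f41f8 p.27 L2–15] Tao 2016 Remark 3.5 =
doi:10.1090/jams/838 (states that (3.24) non-degeneracy holds for generic ξ⁰ and that a no-dilation
Theorem 1.5 «would allow one to establish» but is not pursued — no statement of what replaces the
isosceles-degenerate circuit inputs); tree route PerpetualPump /
`Summit.NavierStokesRegularity.AveragedTypeIBlowup_of` (Type-I blow-up inside M_0, dilations used);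
arXiv:2205.14941 (regularisation by noise of an averaged NS — opposite dir  [refs: 10.1090/jams/838, 2205.14941, paper:url-af84c58f41f8, doi:10.1090/jams/838]

Barriers (technique_class: cascade-blowup-construction, averaged-euler, split-operator): - technique_class: cascade-blowup-construction, averaged-euler, split-operator
- Literature.Barriers.NavierStokesRegularity.TaoAveragedBlowup: not a barrier to this line but its
PARENT (M_0 = `Tao2016.averagedNS_blowup`, tree theorem): the barrier quantifies over REGULARITY
arguments insensitive to the fine structure of B; this route is a blow-up CONSTRUCTION in a
SUB-class and strengthens the barrier (Target → averagedNS_blowup, checked) — outside its technique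
class by direction.
- Literature.Barriers.NavierStokesRegularity.AveragedTypeIBlowup: same family (Type-I rate inside
M_0); regularity-side; our cruxes do not assert a rate and live in the dilation-free sub-class —
consistent, not constrained. Its corollary file `AveragedEquationStepTest.lean`
(`abstractTwoStepFails`, not a catalogued barrier decl): the step test asks every REGULARITY step to
fail for some averaged equation; a construction route is not subject to it (it supplies new test
equations: M_1 would sharpen the test to dilation-free averages).
- Literature.Barriers.NavierStokesRegularity.HyperdissipativeAveragedBlowup: sibling construction
(hyperdissipative averaged blow-up); no constraint on M_1; its evasion list (four-mode gates) is
exactly what C♯ preserves on the symmetric diagonal.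
- Literature.Barriers.NavierStokesRegularity.DyadicCascadeRegularity: the one CONSTRUCTION-side
barrier — unmodified scalar nearest-neighbour (Katz–Pavlović / Cheskidov) cascades at 3-D NS scaling
are globally regular (Barbato

History (route lifecycle, newest last):
- 2026-08-27T11:52:51Z · rev 6: restated SingleScaleNoDilAt (stmt-NavierStokesRegularity-20432) — referee c21 ADVISORY+REQUIRED: SingleScaleNoDilAt v2 — window [3/4,5/4] → [4/5,3/2] so that Tao's xi0 (moduli 1, √2, 1) is an instance (BC5 rung = tree singleSc (planner-harvest-h2-tao-ladder-theory-1-g8-0)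
- 2026-08-27T11:54:04Z · rev 7: restated SplitNoDilPackaging (stmt-NavierStokesRegularity-20434) — referee c21: SplitNoDilPackaging v2 — hypothesis window [3/4,5/4] → [4/5,3/2] to match SingleScaleNoDilAt v2 (glue SingleScaleNoDilAt → CascadeNoDilOfSingleScal (planner-harvest-h2-tao-ladder-theory-1-g8-0)
- 2026-08-27T12:15:28Z · rev 9: informal re-worded for SingleScaleNoDilAt (planner-harvest-h2-tao-ladder-theory-1-g8-0)
- 2026-08-27T12:23:16Z · closes_target -> closes rung TL-M1 of NavierStokesRegularity: Summit.NavierStokesRegularity.NavierStokesRegularity.Theses.TaoLadderRungOne.Target (D-0061; not the summit Statement) (planner-harvest-h2-tao-ladder-theory-1-g8-0)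
- 2026-08-27T14:13:50Z · rev 12: informal re-worded for SplitCascadeIsAveragedNoDilOfSplit (planner-harvest-h2-tao-ladder-theory-1-g9-0)
- 2026-08-27T19:08:06Z · CLOSED proved — proved:Summit.NavierStokesRegularity.NavierStokesRegularity.Theorems.taoLadderRungOne_target_proof (planner-director-ns-g9-0)

sub-problem: NavierStokesRegularity · status: closed(proved) · opened planner-harvest-h2-tao-ladder-theory-1-g3-0 2026-08-27T00:51:19Z · rev 12 · ledger route-NavierStokesRegularity-TaoLadderRungOne
GENERATED by the gate from the ledger (D-0016/17). Provers cite these decls: `theorem foo : Summit.NavierStokesRegularity.NavierStokesRegularity.Theses.TaoLadderRungOne.<Decl> := …` in Summits/NavierStokesRegularity/NavierStokesRegularity/Theorems/<Name>.lean.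
-/

namespace Summit.NavierStokesRegularity.NavierStokesRegularity.Theses.TaoLadderRungOne

open scoped BigOperators Topology Manifold Classical MeasureTheory ProbabilityTheory Matrix InnerProductSpace ComplexConjugate ContinuousMap
open Filter Set Function TopologicalSpace MeasureTheory

attribute [summit_statement] _root_.NavierStokesRegularity
-- H21.Audit: the closer leaf Summit.NavierStokesRegularity.NavierStokesRegularity.Theses.TaoLadderRungOne.Target is an item decl of this route file — tagged summit_statement below, after its declaration

open Literature.NS

/-- item stmt-NavierStokesRegularity-19872 · crux · rank 2 · closed · proved by Summit.NavierStokesRegularity.NavierStokesRegularity.Theorems.splitCascadeBlowup_proof (prover) · by planner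
why it might fail: The two copies of each doubled mode may desynchronise: asymmetries are re-forced at size δₙ by the §4 errors every epoch, and the induction (Prop. 6.5♯ with Y-clauses, ε ≤ exp(−C·10⁷K¹⁰), n₀ ≥ N_Y) must keep them inside the gates' shadowing radius for infinitely many scales — unproved.
sources: Tao2016AveragedNS, arXiv:1402.0290, paper:url-af84c58f41f8
retired/moot children: NoGlobalSplit [moot: ∀ ε₀ : ℝ, 0 < ε₀ → ε₀ < 1 → ∃ K₀ : ℝ, ∀ K : ℝ, K₀ ≤ K → 0 < K → ∃ e₀ : ℝ, 0 < e₀]; SplitFormPackaging [moot: ∀ ε₀ : ℝ, 0 < ε₀ → ε₀ ≤ 1 → ∀ (K ε : ℝ) (𝒟 : Literature.Analysis.FluidPDE.Tao201]; SplitCascadeBlowupOfSplit [moot: NoGlobalSplit → SplitFormPackaging → SplitCascadeBlowup]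
[crux] R1-b «Theorem 3.3♯» (cell LADDER.md §7.11, rung1/TaoLadderRung1.lean `splitCascade_blowup`):
there is ε₂ > 0 such that for every 0 < ε₀ ≤ ε₂ some SPLIT local cascade form T of scale parameter
ε₀ (a finite real combination Σⱼ cⱼ·basicCascadeForm ε₀ ψⱼ₁ ψⱼ₂ ψⱼ₃ whose profiles have annular
Fourier support (3.4) refined to balls of radius ε₀/64 about ±ζⱼᵢ, with input moduli gap |‖ζⱼ₁‖ −
‖ζⱼ₂‖| ≥ ε₀/20) is symmetric in its first two slots, satisfies the cancellation T(u,u,u) = 0 on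
H¹⁰_df, and admits a Schwartz divergence-free datum u₀ from which ∂ₜu = Δu + T(u,u) has no global
mild H¹⁰_df solution on [0,∞). Intended witness: C♯ = Tao's (5.5)/(6.2)-table with each squared mode
doubled (pump X₁′X₁″ → X₂, amplifier X₂′X₂″X₃ → X₃, rotor and output gates acting on the symmetric
combinations), datum loading both copies equally (X(0) = diagEmbed of Tao's datum — NECESSARY by the
cell's staged `not_odeBlowupShape_of_squareFree`), blow-up by Tao's §4 reduction + §5 circuit + §6
induction re-run with an asymmetry (Y) budget. [difficulty: L] -/
@[route_item "route-NavierStokesRegularity-TaoLadderRungOne", crux]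
def SplitCascadeBlowup : Prop :=
  ∃ ε₂ : ℝ, 0 < ε₂ ∧ ∀ ε₀ : ℝ, 0 < ε₀ → ε₀ ≤ ε₂ → ∃ T : Literature.Analysis.FluidPDE.Tao2016.L2C → Literature.Analysis.FluidPDE.Tao2016.L2C → Literature.Analysis.FluidPDE.Tao2016.L2C → ℂ, (∃ (k : ℕ) (c : Fin k → ℝ) (ψ : Fin k → Fin 3 → SchwartzMap (EuclideanSpace ℝ (Fin 3)) (EuclideanSpace ℝ (Fin 3))) (ζ : Fin k → Fin 3 → EuclideanSpace ℝ (Fin 3)), (∀ j i, Literature.Analysis.FluidPDE.Tao2016.HasAnnularFourierSupport ε₀ (ψ j i)) ∧ (∀ j i, ∀ ξ : EuclideanSpace ℝ (Fin 3), ε₀ / 64 < dist ξ (ζ j i) → ε₀ / 64 < dist ξ (-ζ j i) → FourierTransform.fourier (⇑Literature.Analysis.FunctionSpaces.EuclideanSpace.complexify ∘ ⇑(ψ j i)) ξ = 0) ∧ (∀ j, ε₀ / 20 ≤ |‖ζ j 0‖ - ‖ζ j 1‖|) ∧ ∀ u v w, Literature.Analysis.FluidPDE.Tao2016.MemH10df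 u → Literature.Analysis.FluidPDE.Tao2016.MemH10df v → Literature.Analysis.FluidPDE.Tao2016.MemH10dfC w → T u v w = ∑ j, (c j : ℂ) * Literature.Analysis.FluidPDE.Tao2016.basicCascadeForm ε₀ (ψ j 0) (ψ j 1) (ψ j 2) u v w) ∧ (∀ u v w, Literature.Analysis.FluidPDE.Tao2016.MemH10df u → Literature.Analysis.FluidPDE.Tao2016.MemH10df v → Literature.Analysis.FluidPDE.Tao2016.MemH10df w → T u v w = T v u w) ∧ (∀ u, Literature.Analysis.FluidPDE.Tao2016.MemH10df u → T u u u = 0) ∧ ∃ u₀ : SchwartzMap (EuclideanSpace ℝ (Fin 3)) (EuclideanSpace ℝ (Fin 3)), Literature.Analysis.FluidPDE.VectorCalculus.IsDivFree ⇑u₀ ∧ ¬ ∃ u : ℝ → Literature.Analysis.FluidPDE.Tao2016.L2C, Literature.Analysis.FluidPDE.Tao2016.IsMildSolutionFor T (Literature.Analysis.FluidPDE.Tao2016.schwartzL2 u₀) (Set.Ici 0) u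

-- `SplitCascadeBlowup` holds: proved by `Summit.NavierStokesRegularity.NavierStokesRegularity.Theorems.splitCascadeBlowup_proof` (its module imports this route file, so no `_holds` link can be stated here).

/-- item stmt-NavierStokesRegularity-19873 · crux · rank 3 · closed · proved by Summit.NavierStokesRegularity.NavierStokesRegularity.Theorems.SplitClosure.TaoLadderRungOne.SplitCascadeIsAveragedNoDil_holds @ c05e378b40aa (prover) · by planner
why it might fail: Tao proves the dilation-free identity (3.9) only at the normalised triple (3.7); at general admissible triples the (3.24) margin is ~ the input-modulus gap, so the §3.6–3.8 constants degrade like gap⁻¹ and radius ε₀/64 vs gap ε₀/20 may be too weak for ONE uniform ε₁ (else restate: radius ≤ c·gap).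
sources: Tao2016AveragedNS, arXiv:1402.0290, paper:url-af84c58f41f8
retired/moot children: SingleScaleNoDilAt [replaced: ∀ κ : ℝ, 0 < κ → ∃ ε₁ : ℝ, 0 < ε₁ ∧ ∀ ε₀ : ℝ, 0 < ε₀ → ε₀ ≤ ε₁ → ∀ ξ : Fin 3 → E]; SplitNoDilPackaging [replaced: (∀ κ : ℝ, 0 < κ → ∃ ε₁ : ℝ, 0 < ε₁ ∧ ∀ ε₀ : ℝ, 0 < ε₀ → ε₀ ≤ ε₁ → ∀ ξ : Fin 3 → ]
[crux] R1-a «Theorem 3.2♭» (cell LADDER.md §7.11, rung1/TaoLadderRung1.lean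
`splitCascade_isAveragedNoDil`): there is ε₁ > 0 such that for every 0 < ε₀ ≤ ε₁, EVERY split local
cascade form T of scale parameter ε₀ (same clause as in SplitCascadeBlowup) is a dilation-free
averaged Euler form: there is an averaging datum 𝒜 with λ ≡ 1 whose trilinear form B̃_𝒜(u,v,w)
equals T(u,v,w) for all u, v ∈ H¹⁰_df and complex test fields w ∈ H¹⁰_df(ℂ). Route inside the crux
(Tao §3.2–3.9 with (3.7) replaced by a general admissible triple): dyadic shells pass through
rotations and order-zero multipliers, so it suffices to represent one basic split form; decompose
the ball-supported profiles into pieces of radius ≪ ε₀² (§3.6), represent each single-scale piece by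
the uniform no-dilation single-scale lemma L-1q (tree `singleScaleAt_isComplexAverageNoDil_xi0_iff`
gives representability at one admissible triple iff c_σ(ξ⁰) ≠ 0; `norm_cSigma_ge_of_sides_mem_Icc`
gives |c_σ| ≥ (√3/16)·gap uniformly), sum (§3.8) and take real parts (§3.9). [difficulty: L] -/
@[route_item "route-NavierStokesRegularity-TaoLadderRungOne", crux]
def SplitCascadeIsAveragedNoDil : Prop :=
  ∃ ε₁ : ℝ, 0 < ε₁ ∧ ∀ ε₀ : ℝ, 0 < ε₀ → ε₀ ≤ ε₁ → ∀ T : Literature.Analysis.FluidPDE.Tao2016.L2C → Literature.Analysis.FluidPDE.Tao2016.L2C → Literature.Analysis.FluidPDE.Tao2016.L2C → ℂ, (∃ (k : ℕ) (c : Fin k → ℝ) (ψ : Fin k → Fin 3 → SchwartzMap (EuclideanSpace ℝ (Fin 3)) (EuclideanSpace ℝ (Fin 3))) (ζ : Fin k → Fin 3 → EuclideanSpace ℝ (Fin 3)), (∀ j i, Literature.Analysis.FluidPDE.Tao2016.HasAnnularFourierSupport ε₀ (ψ j i)) ∧ (∀ j i, ∀ ξ : EuclideanSpace ℝ (Fin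 3), ε₀ / 64 < dist ξ (ζ j i) → ε₀ / 64 < dist ξ (-ζ j i) → FourierTransform.fourier (⇑Literature.Analysis.FunctionSpaces.EuclideanSpace.complexify ∘ ⇑(ψ j i)) ξ = 0) ∧ (∀ j, ε₀ / 20 ≤ |‖ζ j 0‖ - ‖ζ j 1‖|) ∧ ∀ u v w, Literature.Analysis.FluidPDE.Tao2016.MemH10df u → Literature.Analysis.FluidPDE.Tao2016.MemH10df v → Literature.Analysis.FluidPDE.Tao2016.MemH10dfC w → T u v w = ∑ j, (c j : ℂ) * Literature.Analysis.FluidPDE.Tao2016.basicCascadeForm ε₀ (ψ j 0) (ψ j 1) (ψ j 2) u v w) → ∃ 𝒜 : Literature.Analysis.FluidPDE.Tao2016.AveragingDatum, (∀ i θ, 𝒜.lam i θ = 1) ∧ ∀ u v w, Literature.Analysis.FluidPDE.Tao2016.MemH10df u → Literature.Analysis.FluidPDE.Tao2016.MemH10df v → Literature.Analysis.FluidPDE.Tao2016.MemH10dfC w → 𝒜.form u v w = T u v w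

-- `SplitCascadeIsAveragedNoDil` holds: proved by `Summit.NavierStokesRegularity.NavierStokesRegularity.Theorems.SplitClosure.TaoLadderRungOne.SplitCascadeIsAveragedNoDil_holds` @ c05e378b40aa (its module imports this route file, so no `_holds` link can be stated here).

-- parent: SplitCascadeIsAveragedNoDil · child (gen 1)
/--     item stmt-NavierStokesRegularity-20473 · crux · rank 301 · closed · proved by Summit.NavierStokesRegularity.NavierStokesRegularity.Theorems.taoLadderRungOne_singleScaleNoDilAt_proof (prover)
    parent: SplitCascadeIsAveragedNoDil · by planner
    why it might fail: Binding risk = §3.7: the closing rotations R_{j,ξ} = I + O(ε₀³) come from an IFT proved only at xi0 (`closingRotations_near_xi0`); radii/constants must be UNIFORM over the compact family of closed triangles with sides in [4/5,3/2]. (The (3.24) budget is a tree theorem: gap(η) ≥ κε₀ − 2Cε₀³ on Γ.)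
    sources: Tao2016AveragedNS, §3.5–3.9 (3.9)–(3.24), §3.7 pp. 18–19, Remark 3.5 p. 20, arXiv:1402.0290
[crux] «L-1q uniform» — the harmonic-analysis core of R1-a (MODEL statement, Tao's §3 objects): for
every κ>0 there is ε₁(κ)>0 such that for all 0<ε₀≤ε₁ and EVERY closed base triangle ξ₀+ξ₁+ξ₂=0 with
side lengths in [4/5,3/2] and input-modulus gap |‖ξ₀‖−‖ξ₁‖| ≥ κε₀, and all profiles normalised at ξ
(ψ̂ⱼ ⊆ B(ξⱼ, ε₀³), `Tao2016.NormalisedProfilesAt`), the single-scale form C₀ = ⟨u,ψ̄₁⟩⟨v,ψ̄₂⟩⟨w,ψ̄₃⟩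
(`singleScaleForm`) is a DILATION-FREE complex average (`IsComplexAverageNoDilOf`, Def. 3.4 with
λ≡1) of the single-scale target B_{η,ρ,0;ξ} (`betaRhoZeroFormAt ξ ε₀`, (3.9) with the cut-offs
centred at ξ). The tree proves exactly this sentence at Tao's normalisation xi0 =
((0,1,0),(−1,−1,0),(1,0,0)) only (`singleScale_isComplexAverageNoDil_holds` ↔
`singleScaleAt_isComplexAverageNoDil_xi0_iff`), where the (3.24) margin is absolute; a split form of
Def. 3.1 has all three moduli in [1−2ε₀,1+2ε₀] (near-equilateral triangles), where |c_σ| is only ≍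
gap ≍ ε₀ (`cSigma_eq_zero_of_isosceles`, `norm_cSigma_ge_of_sides_mem_Icc` with r=4/5, R=3/2 (R<2r):
|c_σ| ≥ |⟪u₀×n,η₁⟫|·gap/180 ((2r−R)/(8R²), referee c22 R2)). Proof plan = Tao §3.5–§3.9 re-run with
the base triple as a parameter and constants u -/
@[route_item "route-NavierStokesRegularity-TaoLadderRungOne"]
def SingleScaleNoDilAt : Prop :=
  ∀ κ : ℝ, 0 < κ → ∃ ε₁ : ℝ, 0 < ε₁ ∧ ∀ ε₀ : ℝ, 0 < ε₀ → ε₀ ≤ ε₁ → ∀ ξ : Fin 3 → EuclideanSpace ℝ (Fin 3), ξ 0 + ξ 1 + ξ 2 = 0 → (∀ j, 4 / 5 ≤ ‖ξ j‖ ∧ ‖ξ j‖ ≤ 3 / 2) → κ * ε₀ ≤ |‖ξ 0‖ - ‖ξ 1‖| → ∀ ψ : Fin 3 → SchwartzMap (EuclideanSpace ℝ (Fin 3)) (EuclideanSpace ℂ (Fin 3)), Literature.Analysis.FluidPDE.Tao2016.NormalisedProfilesAt ξ ε₀ ψ → Literature.Analysis.FluidPDE.Tao2016.IsComplexAverageNoDilOf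 (Literature.Analysis.FluidPDE.Tao2016.singleScaleForm (ψ 0) (ψ 1) (ψ 2)) (Literature.Analysis.FluidPDE.Tao2016.betaRhoZeroFormAt ξ ε₀)

-- `SingleScaleNoDilAt` holds: proved by `Summit.NavierStokesRegularity.NavierStokesRegularity.Theorems.taoLadderRungOne_singleScaleNoDilAt_proof` (its module imports this route file, so no `_holds` link can be stated here).

-- parent: SplitCascadeIsAveragedNoDil · child (gen 1)
/--     item stmt-NavierStokesRegularity-20433 · support · rank 302 · closed · proved by Summit.NavierStokesRegularity.NavierStokesRegularity.Theorems.taoLadderRungOne_cascadeNoDilOfSingleScaleAt_proof (prover)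
    parent: SplitCascadeIsAveragedNoDil · by planner
    sources: Tao2016AveragedNS, §3.2 ¶3, §3.3, §3.4 pp. 16–17, arXiv:1402.0290
[support] §3.3–§3.4 + §3.2 ¶3 (transitivity) AT A GENERAL CLOSED BASE TRIPLE with moduli in [1/2,2],
inside the NO-DILATION class (MODEL statement, M): there is an absolute ε₁>0 such that for 0<ε₀≤ε₁,
ξ₀+ξ₁+ξ₂=0, ½≤‖ξⱼ‖≤2 and profiles normalised at ξ, if C₀ (`singleScaleForm`) is a dilation-free
complex average of B_{η,ρ,0;ξ} (`betaRhoZeroFormAt ξ ε₀`) then the complexified basic cascade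
operator (3.6) (`cplxBasicCascadeForm ε₀ ψ₀ ψ₁ ψ₂`) is a dilation-free complex average of B
(`eulerForm`). Proof plan = the tree's facts 2, 6, 3, 4 re-run with xi0 ↦ ξ, eta ↦ `etaAt ξ`, noting
that every datum Tao writes in §3.3–§3.4 has λ≡1: (i) §3.4 `cascade_of_singleScale_holds`
(TaoCascadeOfSingleScale.lean: scaling law Cₙ/B_{η,ρ,n}, m̃=Σₙ m(·/(1+ε₀)ⁿ), cross terms vanish by
the supports B((1+ε₀)ⁿξⱼ, O(ε₀³)), ‖ξⱼ‖≥½ and the η/ρ cut-offs) with a local `betaRhoFormAt ξ ε₀ :=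
Σₙ scaled copies of betaRhoZeroFormAt`; (ii) `betaRhoForm_isComplexAverage_holds`
(TaoAveragedRhoSymbol.lean: one-point datum m₁=ρ, λ=1) and (iii) `betaForm_isComplexAverage_holds`
(TaoAveragedBetaForm.lean / ImaginaryPower: D^{it} datum, λ=1, R=I; φ = Fourier inverse of
(x,y)↦η(1,eˣ,eʸ) with the ratios ‖ξ₁‖/‖ξ₀‖, ‖ξ₂‖/‖ξ₀‖ o -/
@[route_item "route-NavierStokesRegularity-TaoLadderRungOne"]
def CascadeNoDilOfSingleScaleAt : Prop :=
  ∃ ε₁ : ℝ, 0 < ε₁ ∧ ∀ ε₀ : ℝ, 0 < ε₀ → ε₀ ≤ ε₁ → ∀ ξ : Fin 3 → EuclideanSpace ℝ (Fin 3), ξ 0 + ξ 1 + ξ 2 = 0 → (∀ j, 1 / 2 ≤ ‖ξ j‖ ∧ ‖ξ j‖ ≤ 2) → ∀ ψ : Fin 3 → SchwartzMap (EuclideanSpace ℝ (Fin 3)) (EuclideanSpace ℂ (Fin 3)), Literature.Analysis.FluidPDE.Tao2016.NormalisedProfilesAt ξ ε₀ ψ → Literature.Analysis.FluidPDE.Tao2016.IsComplexAverageNoDilOf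 (Literature.Analysis.FluidPDE.Tao2016.singleScaleForm (ψ 0) (ψ 1) (ψ 2)) (Literature.Analysis.FluidPDE.Tao2016.betaRhoZeroFormAt ξ ε₀) → Literature.Analysis.FluidPDE.Tao2016.IsComplexAverageNoDilOf (Literature.Analysis.FluidPDE.Tao2016.cplxBasicCascadeForm ε₀ (ψ 0) (ψ 1) (ψ 2)) Literature.Analysis.FluidPDE.Tao2016.eulerForm

-- `CascadeNoDilOfSingleScaleAt` holds: proved by `Summit.NavierStokesRegularity.NavierStokesRegularity.Theorems.taoLadderRungOne_cascadeNoDilOfSingleScaleAt_proof` (its module imports this route file, so no `_holds` link can be stated here).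

-- parent: SplitCascadeIsAveragedNoDil · child (gen 1)
/--     item stmt-NavierStokesRegularity-20474 · support · rank 303 · closed · proved by Summit.NavierStokesRegularity.NavierStokesRegularity.Theorems.SplitCascadeIsAveragedNoDil.Split.stub_splitNoDilPackaging (prover)
    parent: SplitCascadeIsAveragedNoDil · by planner
    sources: Tao2016AveragedNS, §3.1–3.2 pp. 15–16 and Remark 3.5, arXiv:1402.0290
[support] PACKAGING WITHOUT DILATIONS (MODEL statement, M): if for every κ>0 there is ε₁(κ) such
that for 0<ε₀≤ε₁(κ) every complexified basic cascade operator with profiles normalised at a closed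
triangle with sides in [4/5,3/2] and input gap ≥ κε₀ is a dilation-free complex average of B, then
`SplitCascadeIsAveragedNoDil` (the parent R1-a: every split local cascade form T — real profiles
with annular Fourier support inside B(±ζⱼᵢ, ε₀/64), input-centre gap ≥ ε₀/20 — is the form of an
`AveragingDatum` with λ≡1 on H¹⁰_df × H¹⁰_df × (H¹⁰_df⊗ℂ)). Proof plan = the tree's
`basicCascade_of_normalised_holds` (TaoAveragedCascadeStepsProofs.lean:371) with ROTATIONS ONLY,
then §3.1: (1) pieces of radius r = ε₀³ (`exists_ball_pieces`, `basicCascadeForm_eq_sum_pieces`,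
`summable_cplxCascade_term`); pieces with B(c_a,r) ∩ (B(ζ,ε₀/64)∪B(−ζ,ε₀/64)) = ∅ are 0 (zero form =
NoDil average via a zero datum); for the others ‖c_a‖ ∈ [1−2ε₀−r, 1+2ε₀+r] ⊆ [4/5,3/2] and the input
gap is ≥ ε₀/20 − 2(ε₀/64 + r) ≥ ε₀/64 for ε₀² ≤ 1/640 (take κ = 1/64, or κ = 1/100 with more room);
(2) per piece triple choose a CLOSED triangle ξ with ‖ξᵢ‖ = ‖cᵢ‖ exactly (planar law-of-cosines
construction, cf. `closTarget`; tri -/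
@[route_item "route-NavierStokesRegularity-TaoLadderRungOne"]
def SplitNoDilPackaging : Prop :=
  (∀ κ : ℝ, 0 < κ → ∃ ε₁ : ℝ, 0 < ε₁ ∧ ∀ ε₀ : ℝ, 0 < ε₀ → ε₀ ≤ ε₁ → ∀ ξ : Fin 3 → EuclideanSpace ℝ (Fin 3), ξ 0 + ξ 1 + ξ 2 = 0 → (∀ j, 4 / 5 ≤ ‖ξ j‖ ∧ ‖ξ j‖ ≤ 3 / 2) → κ * ε₀ ≤ |‖ξ 0‖ - ‖ξ 1‖| → ∀ ψ : Fin 3 → SchwartzMap (EuclideanSpace ℝ (Fin 3)) (EuclideanSpace ℂ (Fin 3)), Literature.Analysis.FluidPDE.Tao2016.NormalisedProfilesAt ξ ε₀ ψ → Literature.Analysis.FluidPDE.Tao2016.IsComplexAverageNoDilOf (Literature.Analysis.FluidPDE.Tao2016.cplxBasicCascadeForm ε₀ (ψ 0) (ψ 1) (ψ 2)) Literature.Analysis.FluidPDE.Tao2016.eulerForm) → SplitCascadeIsAveragedNoDil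

-- `SplitNoDilPackaging` holds: proved by `Summit.NavierStokesRegularity.NavierStokesRegularity.Theorems.SplitCascadeIsAveragedNoDil.Split.stub_splitNoDilPackaging` (its module imports this route file, so no `_holds` link can be stated here).

-- parent: SplitCascadeIsAveragedNoDil · glue (gen 1)
/--     item stmt-NavierStokesRegularity-20435 · support · rank 304 · closed · proved by Summit.NavierStokesRegularity.NavierStokesRegularity.Theorems.taoLadderRungOne_splitCascadeIsAveragedNoDilOfSplit_proof (prover)
    parent: SplitCascadeIsAveragedNoDil · GLUE: children ⟹ parent · by planner
SingleScaleNoDilAt → CascadeNoDilOfSingleScaleAt → SplitNoDilPackaging →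
SplitCascadeIsAveragedNoDil: for each κ take ε₁ = min(ε₁ᴷ¹(κ), ε₁ᴷ²) and use the window inclusion
[4/5,3/2] ⊆ [1/2,2]; PROVED and LANDED —
Theorems/TaoLadderRungOneSplitCascadeIsAveragedNoDilOfSplit.lean,
`taoLadderRungOne_splitCascadeIsAveragedNoDilOfSplit_proof` (item CLOSED proved). Model lattice /
averaged-operator class only; nothing about NS. -/
@[route_item "route-NavierStokesRegularity-TaoLadderRungOne"]
def SplitCascadeIsAveragedNoDilOfSplit : Prop :=
  SingleScaleNoDilAt → CascadeNoDilOfSingleScaleAt → SplitNoDilPackaging → SplitCascadeIsAveragedNoDil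

-- `SplitCascadeIsAveragedNoDilOfSplit` holds: proved by `Summit.NavierStokesRegularity.NavierStokesRegularity.Theorems.taoLadderRungOne_splitCascadeIsAveragedNoDilOfSplit_proof` (its module imports this route file, so no `_holds` link can be stated here).

/-- item stmt-NavierStokesRegularity-19871 · aside · rank 0 · closed · proved by Summit.NavierStokesRegularity.NavierStokesRegularity.Theorems.taoLadderRungOne_target_proof (prover) · by planner
why it might fail: Without dilations the averaged class may be too rigid for ANY blow-up: the isosceles degeneracy already kills Tao's own operator C, and a second hidden obstruction (output/rotor couplings at general triples, or an n₀-dependence that cannot close) could make every dilation-free datum regular.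
sources: Tao2016AveragedNS, doi:10.1090/jams/838, arXiv:1402.0290, paper:url-af84c58f41f8
[target] M_1 = Tao's Theorem 1.5 without dilation averaging: there is an averaging datum 𝒜 = (Ω, μ,
m, R, λ) with λ ≡ 1 (rotations in SO(3) and real, even, order-zero multipliers only), symmetric (B̃
invariant under permuting the three tensor slots of m and R) and cancelling (⟨B̃(u,u),u⟩ = 0 on
H¹⁰_df), and a Schwartz divergence-free u₀, such that the averaged Navier–Stokes equation has NO
global mild H¹⁰_df solution on [0,∞) from u₀ (by Tao's local theory, Prop. 1.6, equivalently: the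
maximal mild solution blows up in finite time). This is the rung leaf; it is decided by `closes`
from the two cruxes. -/
@[route_item "route-NavierStokesRegularity-TaoLadderRungOne"]
def Target : Prop :=
  ∃ 𝒜 : Literature.Analysis.FluidPDE.Tao2016.AveragingDatum, (∀ i θ, 𝒜.lam i θ = 1) ∧ 𝒜.IsSymmetric ∧ 𝒜.HasCancellation ∧ ∃ u₀ : SchwartzMap (EuclideanSpace ℝ (Fin 3)) (EuclideanSpace ℝ (Fin 3)), Literature.Analysis.FluidPDE.VectorCalculus.IsDivFree ⇑u₀ ∧ ¬ ∃ u : ℝ → Literature.Analysis.FluidPDE.Tao2016.L2C, 𝒜.IsMildSolution (Literature.Analysis.FluidPDE.Tao2016.schwartzL2 u₀) (Set.Ici 0) u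

-- `Target` holds: proved by `Summit.NavierStokesRegularity.NavierStokesRegularity.Theorems.taoLadderRungOne_target_proof` (its module imports this route file, so no `_holds` link can be stated here).

/-- item stmt-NavierStokesRegularity-19874 · assembly · rank 1 · closed · proved by Summit.NavierStokesRegularity.NavierStokesRegularity.Theorems.taoLadderRungOne_assembly_proof (prover) · by planner
sources: Tao2016AveragedNS, arXiv:1402.0290
[assembly] SplitCascadeIsAveragedNoDil → SplitCascadeBlowup → Target (the rung leaf M_1; NOT the
summit `NavierStokesRegularity`, which this route does not conclude — class rung, D-0061). -/
@[route_item "route-NavierStokesRegularity-TaoLadderRungOne"]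
def Assembly : Prop :=
  SplitCascadeIsAveragedNoDil → SplitCascadeBlowup → Target

-- `Assembly` holds: proved by `Summit.NavierStokesRegularity.NavierStokesRegularity.Theorems.taoLadderRungOne_assembly_proof` (its module imports this route file, so no `_holds` link can be stated here).

attribute [summit_statement] _root_.Summit.NavierStokesRegularity.NavierStokesRegularity.Theses.TaoLadderRungOne.Target

/-! D-0027 §2.1 — DECIDING THEOREM (planner-authored via `route open/edit --closes-file`; by planner-harvest-h2-tao-ladder-theory-1-g8-0 2026-08-27T12:23:16Z) — ARCHIVED: route closed (proved) 2026-08-27T19:08:06Z; kept so importers keep building: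
its hypotheses are this route's items and its conclusion the registered leaf `Summit.NavierStokesRegularity.NavierStokesRegularity.Theses.TaoLadderRungOne.Target` (rung TL-M1, D-0061) (glue_lint), and it elaborates with this file. -/

/-- DECIDING THEOREM: the rung-1 assembly R1-a → R1-b → M₁ — Tao's «Theorem 1.5 ⇐ Theorems 3.2 +
3.3» (p. 14) with the dilation constraint carried through: at `ε₀ = min ε₁ ε₂`, R1-b gives a
symmetric cancelling split form `T` and a datum; R1-a gives a dilation-free `𝒜` with `B̃_𝒜 = T`
on `H¹⁰_df × H¹⁰_df × (H¹⁰_df ⊗ ℂ)`; a global mild solution for `B̃_𝒜` would be one for `T`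
(the Duhamel identity only tests the forms on `(u(s), u(s), e^{(t-s)Δ}w)`, `MemH10dfC.heat`).
Port of theory-1 g2's kernel-checked `noDilationAveragedNSBlowup_of_split`
(HOME/rung1/TaoLadderRung1.lean c2e595d8605deeed). -/
@[closes "route-NavierStokesRegularity-TaoLadderRungOne"] theorem closes (h₁ : SplitCascadeIsAveragedNoDil) (h₂ : SplitCascadeBlowup) : Target := by
  obtain ⟨ε₁, hε₁, ha⟩ := h₁
  obtain ⟨ε₂, hε₂, hb⟩ := h₂
  have hε₀ : 0 < min ε₁ ε₂ := lt_min hε₁ hε₂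
  obtain ⟨T, hT, hsymm, hcanc, u₀, hdiv, hno⟩ := hb _ hε₀ (min_le_right _ _)
  obtain ⟨𝒜, hfree, h𝒜⟩ := ha _ hε₀ (min_le_left _ _) T hT
  refine ⟨𝒜, hfree, fun u v w hu hv hw => ?_, fun u hu => ?_, u₀, hdiv, ?_⟩
  · rw [h𝒜 u v w hu hv hw.memH10dfC, h𝒜 v u w hv hu hw.memH10dfC]
    exact hsymm u v w hu hv hw
  · rw [h𝒜 u u u hu hu hu.memH10dfC]
    exact hcanc u hu
  · rintro ⟨u, hu⟩
    have hu' : Literature.Analysis.FluidPDE.Tao2016.IsMildSolutionFor 𝒜.form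
        (Literature.Analysis.FluidPDE.Tao2016.schwartzL2 u₀) (Set.Ici 0) u := hu
    refine hno ⟨u, hu'.1, hu'.2.1, fun t ht w hw => ?_⟩
    rw [hu'.2.2 t ht w hw]
    congr 1
    refine intervalIntegral.integral_congr fun s hs => ?_
    have hs0 : (0 : ℝ) ≤ s := by
      rw [Set.uIcc_of_le (show (0 : ℝ) ≤ t from ht)] at hs
      exact hs.1
    exact h𝒜 _ _ _ (hu'.1 s hs0) (hu'.1 s hs0) (hw.memH10dfC.heat _)

end Summit.NavierStokesRegularity.NavierStokesRegularity.Theses.TaoLadderRungOne
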